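import Summits.HodgeConjecture.HodgeConjecture.Theorems.NikulinTwinTransportRealMultiplicationOfFacts
import Summits.HodgeConjecture.HodgeConjecture.Theorems.NikulinTwinTransportSquareTranscendental

/-!
# Route NikulinTwinTransport · `RealMultiplicationSqrtTwoAlgebraic` (stmt-HodgeConjecture-13679) —
# the converse: RM-anchors FROM algebraic real multiplication

Sibling of `NikulinTwinTransportRealMultiplicationPointwise` (anchor into `S` + Buskin + composition
of correspondences ⟹ X at `(S, ·)` ⟹ real multiplication algebraic at `S`). Here the converse at a
surface: if the real multiplication `e` (rational, type-preserving, cup-self-adjoint, killing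
`NS := algebraicClasses S 1`, `e² = 2` on `NS^⊥`) IS algebraic on `S × S`, then `S` is its own
RM-anchor partner — `S″ := S`, `Ψ := Ξ = e + ν̃`, seat 3's Witt-corrected rational Hodge
`2`-similitude of `H²(S(ℂ); ℂ)` (`exists_ratCorrection`):

* `rmAnchor_at_of_realMultiplication_algebraic_at` — `Ξ` is a `ℂ`-linear equivalence (a
  `2`-similitude of the non-degenerate cup form is injective; `H²` is finite-dimensional through
  the marking), `Ξ⁻¹` is rational (`ηΞη⁻¹|_{Λ_ℚ} = ξ` is a bijective rational map), type-preserving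
  (`Ξ` acts on the lines `H^{2,0} = ℂσ`, `H^{0,2} = ℂσ̄` by non-zero scalars and preserves
  `H^{1,1} = ⟨σ, σ̄⟩^⊥` by `Ξx.Ξy = 2(x.y)`) and halves cup products, and `Ξ = [γ_e]_* + Σᵢ [γᵢ]_*`
  is algebraic (the `γᵢ` divisor correspondences: `divisorCorrespondence_of_fibreIntegral`, fibre
  integration from the Künneth theorem `kunnethSpan_complexBetti`);
* `rmAnchors_of_realMultiplicationSqrtTwoAlgebraic` — globally: the route decl
  `RealMultiplicationSqrtTwoAlgebraic` and the three named facts give an RM-anchor (in the sense of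
  the cruxes `TwinTwistorTransport` / `TwinTransportRMPicardTwo`: partner, generator, algebraic
  `Ψ` with rational type-preserving form-halving inverse) at EVERY projective K3 surface carrying
  such an `e`, every Picard rank.

With the sibling file this makes, surface by surface and modulo Buskin + composition of
correspondences + the three facts, "`e` algebraic" ⟺ "an RM-anchor into `S`" ⟺ "X at `(S, S)`".
Caveat for the planner: the crux `TwinTransportRMPicardTwo` does not assume `e` self-adjoint
(Zarhin's theorem makes it automatic in print, not in the tree), so this converse does not conclude
that crux by name. Prover seat prover-pitem-stmt-HodgeConjecture-13679-1.

## References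

* [Varesco2023] M. Varesco, Math. Z. 305 (2023), §2, Rem. 2.2.
* [Huybrechts2016K3] D. Huybrechts, Lectures on K3 Surfaces, Ch. 3 §3, Ch. 6 Prop. 1.2, Ch. 14 §0.3.
* [Zarhin1983] Yu. G. Zarhin, J. reine angew. Math. 341 (1983), Thm. 1.5.1 (self-adjointness).
-/

noncomputable section

namespace Summit.HodgeConjecture.HodgeConjecture.Theorems.NikulinTwinTransport

open scoped Manifold
open CategoryTheory MonoidalCategory SemiCartesianMonoidalCategory
open Literature.AlgebraicGeometry.Motives Literature.AlgebraicGeometry.HodgeTheory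
open Literature.AlgebraicGeometry.Surfaces Literature.Geometry.Kaehler
open Literature.AlgebraicTopology.SingularHomology

/-- **An RM-anchor from an algebraic real multiplication** (converse of the pointwise chain at a
surface, for cup-self-adjoint `e`): if `e` — rational, type-preserving, self-adjoint, killing `NS`,
`e² = 2` on `NS^⊥` — is algebraic on `S × S`, then `S″ := S`, `p″ := p` and
`Ψ := Ξ = e + ν̃` (seat 3's Witt-corrected rational Hodge `2`-similitude of `H²(S)`) is an anchor
in the sense of the cruxes `TwinTwistorTransport` / `TwinTransportRMPicardTwo`: `Ξ` is a `ℂ`-linear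
equivalence (a `2`-similitude of the non-degenerate cup form is injective), its inverse is rational
(`ηΞη⁻¹` restricts to the bijective rational `ξ` on `Λ_ℚ`), type-preserving (`Ξ` preserves the
lines `H^{2,0} = ℂσ`, `H^{0,2} = ℂσ̄` with non-zero eigenvalues and `H^{1,1} = ⟨σ, σ̄⟩^⊥` by the
similitude identity) and halves cup products, and `Ξ = [γ_e]_* + Σᵢ [γᵢ]_*` is algebraic (divisor
correspondences from the Künneth theorem). [cite: Varesco2023, §2 and Rem. 2.2]
[cite: Huybrechts2016K3, Ch. 6 Prop. 1.2] -/
theorem rmAnchor_at_of_realMultiplication_algebraic_at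
    (hmark : Huybrechts_K3_marking_exists) (hHT : Huybrechts_K3_hodgeTypes_H2)
    (hG : Grothendieck1969_supportedClasses_le_hodgeConiveau)
    (μ : OrientationFamily) (hμ : μ.HasPoincareDuality) {S : SchemeOver ℂ} (hS : IsK3Surface S)
    (p : complexBetti S (2 * 2))
    (hp : IsIntegralClass p ∧ ∀ q : complexBetti S (2 * 2), IsIntegralClass q → ∃ n : ℤ, q = n • p)
    (e : complexBetti S (2 * 1) →ₗ[ℂ] complexBetti S (2 * 1))
    (he_rat : ∀ x, IsRationalClass x → IsRationalClass (e x))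
    (he_type : ∀ (i j : ℕ) x, IsOfHodgeType 2 S (2 * 1) i j x → IsOfHodgeType 2 S (2 * 1) i j (e x))
    (he_adj : ∀ x y : complexBetti S (2 * 1),
      cupProduct (rfl : 2 * 1 + 2 * 1 = 2 * 2) (e x) y =
        cupProduct (rfl : 2 * 1 + 2 * 1 = 2 * 2) x (e y))
    (he_N : ∀ d ∈ algebraicClasses S 1, e d = 0)
    (he_T : ∀ x : complexBetti S (2 * 1),
      (∀ d ∈ algebraicClasses S 1, cupProduct (rfl : 2 * 1 + 2 * 1 = 2 * 2) x d = 0) →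
        e (e x) = (2 : ℂ) • x)
    (he_alg : ∃ γ ∈ algebraicClasses (S ⊗ S) 2, ∀ x : complexBetti S (2 * 1),
      e x = complexGysin μ (IsSmoothProjective.tensor_holds hS.1 hS.1) hS.1 (fst S S)
        (rfl : 2 * 1 + 2 * 2 + 2 * 2 = 2 * 1 + 2 * (2 + 2))
        (cupProduct (rfl : 2 * 1 + 2 * 2 = 2 * 1 + 2 * 2)
          (complexBetti.map (snd S S) (2 * 1) x) γ)) :
    ∃ (S'' : SchemeOver ℂ) (hS'' : IsK3Surface S'') (p'' : complexBetti S'' (2 * 2)),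
      (IsIntegralClass p'' ∧
        ∀ q : complexBetti S'' (2 * 2), IsIntegralClass q → ∃ n : ℤ, q = n • p'') ∧
      ∃ Ψ : complexBetti S'' (2 * 1) ≃ₗ[ℂ] complexBetti S (2 * 1),
        (∀ y, IsRationalClass y → IsRationalClass (Ψ.symm y)) ∧
        (∀ (i j : ℕ) y, IsOfHodgeType 2 S (2 * 1) i j y →
          IsOfHodgeType 2 S'' (2 * 1) i j (Ψ.symm y)) ∧
        (∀ (u v : complexBetti S (2 * 1)) (b : ℂ),
          cupProduct (rfl : 2 * 1 + 2 * 1 = 2 * 2) u v = ((2 : ℂ) * b) • p →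
            cupProduct (rfl : 2 * 1 + 2 * 1 = 2 * 2) (Ψ.symm u) (Ψ.symm v) = b • p'') ∧
        ∃ γ ∈ algebraicClasses (S ⊗ S'') 2, ∀ x : complexBetti S'' (2 * 1),
          Ψ x = complexGysin μ (IsSmoothProjective.tensor_holds hS.1 hS''.1) hS.1 (fst S S'')
            (rfl : 2 * 1 + 2 * 2 + 2 * 2 = 2 * 1 + 2 * (2 + 2))
            (cupProduct (rfl : 2 * 1 + 2 * 2 = 2 * 1 + 2 * 2)
              (complexBetti.map (snd S S'') (2 * 1) x) γ) := by
  -- a marking of `S` and the rational correction (Witt), as in `realMultiplication_algebraic_at`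
  obtain ⟨η, p₀, x₀, hp₀, ⟨hp₀int, hp₀gen, hηint, hηcup, h20, -⟩, ⟨-, hxpos, -⟩⟩ := hmark S hS
  obtain ⟨m, a, b, ξ, ha, hb, hξ, hKB⟩ :=
    exists_ratCorrection hS η p₀ hp₀ hηint hηcup e he_rat he_adj he_N he_T
  set ψ : Fin m → (complexBetti S (2 * 1) →ₗ[ℂ] complexBetti S (2 * 1)) := fun i =>
    ((k3FormC.flip fun j => (a i j : ℂ)) ∘ₗ η.toLinearMap).smulRight (η.symm fun j => (b i j : ℂ))
    with hψdef
  have hψ : ∀ i x, ψ i x = k3Form (η x) (fun j => (a i j : ℂ)) • η.symm (fun j => (b i j : ℂ)) := by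
    intro i x
    rw [hψdef]
    change ((k3FormC.flip fun j => (a i j : ℂ)) ∘ₗ η.toLinearMap) x • η.symm (fun j => (b i j : ℂ)) = _
    rw [LinearMap.comp_apply, LinearEquiv.coe_coe, LinearMap.BilinForm.flip_apply, k3FormC_apply]
  set ν : complexBetti S (2 * 1) →ₗ[ℂ] complexBetti S (2 * 1) := ∑ i, ψ i with hνdef
  have hν : ∀ x, ν x = ∑ i, k3Form (η x) (fun j => (a i j : ℂ)) • η.symm (fun j => (b i j : ℂ)) := by
    intro x
    rw [hνdef, LinearMap.sum_apply]
    exact Finset.sum_congr rfl fun i _ => hψ i x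
  have hσ0 : η.symm x₀ ≠ 0 := fun h0 =>
    ne_zero_of_star_self_re_pos hxpos (by simpa using congrArg η h0)
  obtain ⟨h1, h2, h3⟩ := hHT S hS (η.symm x₀) h20 hσ0
  rw [conjClass_marking_symm η hηint] at h2 h3
  have hN11 : ∀ d ∈ algebraicClasses S 1, IsOfHodgeType 2 S (2 * 1) 1 1 d :=
    fun d hd => isOfHodgeType_oneOne_of_mem_algebraicClasses hG hS hd
  have horth : ∀ w : K3Index → ℚ, η.symm (fun j => (w j : ℂ)) ∈ algebraicClasses S 1 →
      k3Form (fun j => (w j : ℂ)) x₀ = 0 ∧ k3Form (fun j => (w j : ℂ)) (star x₀) = 0 := by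
    intro w hw
    obtain ⟨hw1, hw2⟩ := (h3 _).1 (hN11 _ hw)
    rw [hηcup, LinearEquiv.apply_symm_apply, LinearEquiv.apply_symm_apply, smul_eq_zero] at hw1 hw2
    exact ⟨hw1.resolve_right hp₀, hw2.resolve_right hp₀⟩
  -- the three properties of `Ξ = e + ν̃` proved by seat 3
  have hΞr := isRationalClass_add_correction hS η hηint e ν a b ξ hν hKB
  have hΞt := isOfHodgeType_add_correction hS η p₀ hηcup x₀ h1 h2 h3 e ν he_type a b hν
    (fun i => horth _ (ha i)) (fun i => horth _ (hb i))
  have hΞs := cupProduct_add_correction η p₀ hp₀ hηcup e ν a b ξ hν hKB hξ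
  -- the similitude identity `Ξx.Ξy = 2 (x.y)`
  have hΞ2 : ∀ x y : complexBetti S (2 * 1),
      cupProduct (rfl : 2 * 1 + 2 * 1 = 2 * 2) ((e + ν) x) ((e + ν) y) =
        (2 : ℂ) • cupProduct (rfl : 2 * 1 + 2 * 1 = 2 * 2) x y := by
    intro x y
    rw [hΞs x y (k3Form (η x) (η y)) (hηcup x y), hηcup x y, smul_smul]
  -- `Ξ` is injective: a `2`-similitude of the non-degenerate cup form
  have hinj : Function.Injective (e + ν) := by
    refine (injective_iff_map_eq_zero _).2 fun x hx => ?_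
    have hx0 : ∀ y, k3Form (η x) (η y) = 0 := fun y => by
      have h := hΞ2 x y
      rw [hx, map_zero, LinearMap.zero_apply, hηcup, smul_smul] at h
      exact (mul_eq_zero.1 ((smul_eq_zero.1 h.symm).resolve_right hp₀)).resolve_left two_ne_zero
    have hηx : η x = 0 := k3FormC_nondegenerate.1 (η x) fun w => by
      rw [k3FormC_apply, ← η.apply_symm_apply w]
      exact hx0 _
    simpa using congrArg η.symm hηx
  haveI : FiniteDimensional ℂ (complexBetti S (2 * 1)) := LinearEquiv.finiteDimensional η.symm
  have hbij : Function.Bijective (e + ν) := ⟨hinj, LinearMap.injective_iff_surjective.1 hinj⟩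
  set Ψ : complexBetti S (2 * 1) ≃ₗ[ℂ] complexBetti S (2 * 1) := LinearEquiv.ofBijective (e + ν) hbij
    with hΨdef
  have hΨ : ∀ x, Ψ x = (e + ν) x := fun x => rfl
  have hΨsymm : ∀ y, (e + ν) (Ψ.symm y) = y := fun y => by rw [← hΨ, LinearEquiv.apply_symm_apply]
  -- `ξ` is bijective on `Λ_ℚ`
  have hξinj : Function.Injective ξ := by
    refine (injective_iff_map_eq_zero _).2 fun u hu => k3FormRat_nondegenerate.1 u fun v => ?_
    have h := hξ u v
    rw [hu, map_zero, LinearMap.zero_apply] at h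
    exact (mul_eq_zero.1 h.symm).resolve_left two_ne_zero
  have hξsurj : Function.Surjective ξ := LinearMap.injective_iff_surjective.1 hξinj
  refine ⟨S, hS, p, hp, Ψ, ?_, ?_, ?_, ?_⟩
  · -- the inverse is rational
    intro y hy
    obtain ⟨u, hu⟩ := (isRationalClass_iff_of_marking hS η hηint y).1 hy
    obtain ⟨u', rfl⟩ := hξsurj u
    have hy' : (e + ν) (η.symm fun j => (u' j : ℂ)) = y := by
      apply η.injective
      rw [marking_add_correction_ratCast η e ν a b ξ hν hKB u', hu]
    have : Ψ.symm y = η.symm fun j => (u' j : ℂ) := by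
      rw [LinearEquiv.symm_apply_eq, hΨ, hy']
    rw [this]
    exact (isRationalClass_iff_of_marking hS η hηint _).2 ⟨u', by rw [LinearEquiv.apply_symm_apply]⟩
  · -- the inverse preserves the Hodge types
    intro i j y hy
    by_cases hij : i + j = 2 * 1
    · -- eigenvalues of `Ξ` on the lines `ℂσ`, `ℂσ̄`
      have hstar0 : η.symm (star x₀) ≠ 0 := fun h0 => by
        apply hσ0
        have : star x₀ = 0 := by simpa using congrArg η h0
        rw [show x₀ = star (star x₀) from (star_star x₀).symm, this, star_zero, map_zero]
      obtain ⟨t₁, ht₁⟩ := (h1 _).1 (hΞt 2 0 _ ((h1 _).2 ⟨1, (one_smul ℂ _).symm⟩))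
      obtain ⟨t₂, ht₂⟩ := (h2 _).1 (hΞt 0 2 _ ((h2 _).2 ⟨1, (one_smul ℂ _).symm⟩))
      have ht₁0 : t₁ ≠ 0 := by
        rintro rfl
        exact hσ0 (hinj (by rw [ht₁, zero_smul, map_zero]))
      have ht₂0 : t₂ ≠ 0 := by
        rintro rfl
        exact hstar0 (hinj (by rw [ht₂, zero_smul, map_zero]))
      have hσinv : Ψ.symm (η.symm x₀) = t₁⁻¹ • η.symm x₀ := by
        rw [LinearEquiv.symm_apply_eq, map_smul, hΨ, ht₁, smul_smul, inv_mul_cancel₀ ht₁0, one_smul]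
      have hσ'inv : Ψ.symm (η.symm (star x₀)) = t₂⁻¹ • η.symm (star x₀) := by
        rw [LinearEquiv.symm_apply_eq, map_smul, hΨ, ht₂, smul_smul, inv_mul_cancel₀ ht₂0, one_smul]
      obtain ⟨rfl, rfl⟩ | ⟨rfl, rfl⟩ | ⟨rfl, rfl⟩ :
          (i = 2 ∧ j = 0) ∨ (i = 0 ∧ j = 2) ∨ (i = 1 ∧ j = 1) := by omega
      · obtain ⟨t, rfl⟩ := (h1 y).1 hy
        exact (h1 _).2 ⟨t * t₁⁻¹, by rw [map_smul, hσinv, smul_smul]⟩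
      · obtain ⟨t, rfl⟩ := (h2 y).1 hy
        exact (h2 _).2 ⟨t * t₂⁻¹, by rw [map_smul, hσ'inv, smul_smul]⟩
      · obtain ⟨hy1, hy2⟩ := (h3 y).1 hy
        refine (h3 _).2 ⟨?_, ?_⟩
        · have h := hΞ2 (Ψ.symm y) (η.symm x₀)
          rw [hΨsymm, ht₁, map_smul, hy1, smul_zero] at h
          exact ((smul_eq_zero.1 h.symm).resolve_left two_ne_zero)
        · have h := hΞ2 (Ψ.symm y) (η.symm (star x₀))
          rw [hΨsymm, ht₂, map_smul, hy2, smul_zero] at h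
          exact ((smul_eq_zero.1 h.symm).resolve_left two_ne_zero)
    · obtain rfl := isOfHodgeType_eq_zero_of_add_ne hy hij
      rw [map_zero]
      obtain ⟨A⟩ := hS.nonempty_hodgeModel
      exact IsOfHodgeType.zero A _ _ _
  · -- the inverse halves cup products
    intro u v c huv
    have h := hΞ2 (Ψ.symm u) (Ψ.symm v)
    rw [hΨsymm, hΨsymm, huv, mul_smul] at h
    exact (smul_right_injective _ (two_ne_zero' ℂ) h).symm
  · -- `Ξ = e + ν̃` is algebraic: `e` by hypothesis, `ν̃` as a sum of divisor correspondences
    obtain ⟨c, hc, hκ⟩ := fibreIntegral_of_kunnethTop μ hS.1 hS.1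
      (kunnethSpan_complexBetti hS.1 hS.1 (2 * (2 + 2))) hp₀
    have hψind : ∀ i ∈ (Finset.univ : Finset (Fin m)), ∃ γ' ∈ algebraicClasses (S ⊗ S) 2,
        ∀ x : complexBetti S (2 * 1), ψ i x =
          complexGysin μ (IsSmoothProjective.tensor_holds hS.1 hS.1) hS.1 (fst S S)
            (rfl : 2 * 1 + 2 * 2 + 2 * 2 = 2 * 1 + 2 * (2 + 2))
            (cupProduct (rfl : 2 * 1 + 2 * 2 = 2 * 1 + 2 * 2)
              (complexBetti.map (snd S S) (2 * 1) x) γ') := by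
      intro i _
      obtain ⟨γ', hγ', hγ'eq⟩ :=
        divisorCorrespondence_of_fibreIntegral μ hμ S hS p₀ c hc hκ (ha i) (hb i)
      refine ⟨γ', hγ', fun x => ?_⟩
      rw [hψ i x]
      exact (hγ'eq x _ (by rw [hηcup, LinearEquiv.apply_symm_apply])).symm
    have hνind := induced_sum (IsSmoothProjective.tensor_holds hS.1 hS.1) hS.1
      (rfl : 2 * 1 + 2 * 2 = 2 * 1 + 2 * 2) (rfl : 2 * 1 + 2 * 2 + 2 * 2 = 2 * 1 + 2 * (2 + 2))
      Finset.univ ψ hψind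
    have h := induced_add (IsSmoothProjective.tensor_holds hS.1 hS.1) hS.1
      (rfl : 2 * 1 + 2 * 2 = 2 * 1 + 2 * 2) (rfl : 2 * 1 + 2 * 2 + 2 * 2 = 2 * 1 + 2 * (2 + 2))
      he_alg hνind
    rw [← hνdef] at h
    obtain ⟨γ, hγ, hΞγ⟩ := h
    exact ⟨γ, hγ, fun x => by rw [hΨ, hΞγ x]⟩

/-- **The deliverable yields RM-anchors at every RM-`√2` surface** (all Picard ranks): granted the
route decl `RealMultiplicationSqrtTwoAlgebraic` and the three named facts, every projective K3
surface `S` carrying a rational, type-preserving, cup-self-adjoint `e` killing `NS` with `e² = 2`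
on `NS^⊥` has, for every integral generator `p` of `H⁴(S(ℂ))`, a projective K3 partner (namely `S`)
and an algebraic `ℂ`-linear equivalence `Ψ : H²(S″) ≃ H²(S)` whose inverse is a rational,
type-preserving `½`-similitude — the conclusion of crux `TwinTransportRMPicardTwo` verbatim, for
self-adjoint `e` and without the Picard-rank clause. [cite: Varesco2023, §2 and Rem. 2.2]
[cite: Zarhin1983, Thm. 1.5.1] -/
theorem rmAnchors_of_realMultiplicationSqrtTwoAlgebraic
    (h : Theses.NikulinTwinTransport.RealMultiplicationSqrtTwoAlgebraic)
    (hmark : Huybrechts_K3_marking_exists) (hHT : Huybrechts_K3_hodgeTypes_H2)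
    (hG : Grothendieck1969_supportedClasses_le_hodgeConiveau)
    (μ : OrientationFamily) (hμ : μ.HasPoincareDuality) {S : SchemeOver ℂ} (hS : IsK3Surface S)
    (p : complexBetti S (2 * 2))
    (hp : IsIntegralClass p ∧ ∀ q : complexBetti S (2 * 2), IsIntegralClass q → ∃ n : ℤ, q = n • p)
    (e : complexBetti S (2 * 1) →ₗ[ℂ] complexBetti S (2 * 1))
    (he_rat : ∀ x, IsRationalClass x → IsRationalClass (e x))
    (he_type : ∀ (i j : ℕ) x, IsOfHodgeType 2 S (2 * 1) i j x → IsOfHodgeType 2 S (2 * 1) i j (e x))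
    (he_adj : ∀ x y : complexBetti S (2 * 1),
      cupProduct (rfl : 2 * 1 + 2 * 1 = 2 * 2) (e x) y =
        cupProduct (rfl : 2 * 1 + 2 * 1 = 2 * 2) x (e y))
    (he_N : ∀ d ∈ algebraicClasses S 1, e d = 0)
    (he_T : ∀ x : complexBetti S (2 * 1),
      (∀ d ∈ algebraicClasses S 1, cupProduct (rfl : 2 * 1 + 2 * 1 = 2 * 2) x d = 0) →
        e (e x) = (2 : ℂ) • x) :
    ∃ (S'' : SchemeOver ℂ) (hS'' : IsK3Surface S'') (p'' : complexBetti S'' (2 * 2)),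
      (IsIntegralClass p'' ∧
        ∀ q : complexBetti S'' (2 * 2), IsIntegralClass q → ∃ n : ℤ, q = n • p'') ∧
      ∃ Ψ : complexBetti S'' (2 * 1) ≃ₗ[ℂ] complexBetti S (2 * 1),
        (∀ y, IsRationalClass y → IsRationalClass (Ψ.symm y)) ∧
        (∀ (i j : ℕ) y, IsOfHodgeType 2 S (2 * 1) i j y →
          IsOfHodgeType 2 S'' (2 * 1) i j (Ψ.symm y)) ∧
        (∀ (u v : complexBetti S (2 * 1)) (b : ℂ),
          cupProduct (rfl : 2 * 1 + 2 * 1 = 2 * 2) u v = ((2 : ℂ) * b) • p →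
            cupProduct (rfl : 2 * 1 + 2 * 1 = 2 * 2) (Ψ.symm u) (Ψ.symm v) = b • p'') ∧
        ∃ γ ∈ algebraicClasses (S ⊗ S'') 2, ∀ x : complexBetti S'' (2 * 1),
          Ψ x = complexGysin μ (IsSmoothProjective.tensor_holds hS.1 hS''.1) hS.1 (fst S S'')
            (rfl : 2 * 1 + 2 * 2 + 2 * 2 = 2 * 1 + 2 * (2 + 2))
            (cupProduct (rfl : 2 * 1 + 2 * 2 = 2 * 1 + 2 * 2)
              (complexBetti.map (snd S S'') (2 * 1) x) γ) :=
  rmAnchor_at_of_realMultiplication_algebraic_at hmark hHT hG μ hμ hS p hp e he_rat he_type he_adj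
    he_N he_T (h μ hμ S hS e he_rat he_type he_adj he_N he_T)

end Summit.HodgeConjecture.HodgeConjecture.Theorems.NikulinTwinTransport

end
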